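import Literature.Analysis.SpecialFunctions.OblateSpheroidalSphereBasis
import HarnessLib

/-!
# The weak eigen-equation of the oblate spheroidal harmonics against weak Laplacian pairs

Dafermos–Rodnianski–Shlapentokh-Rothman, arXiv:1402.7034, §5.2.1 (32): the oblate spheroidal
harmonics are eigenfunctions of `P(ν) = -Δ̸ - ν² cos²θ`. In the tree `Ψ_q = oblateSphereBasis T ν q`
is an abstract `L²` eigenbasis whose eigen-equation is known against the smooth basis
`Y_{m,k} = sphHarmTensor T m k` (`oblateSphere_weak`) and, for `T = 2π`, against every `C²` test
function (`oblateSphere_weak_polar`). For separated wave equations after a Fourier transform in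
time the data `(u, s)` — a function and "its `-Δ̸`" — are only `L²` classes; this file extends
the eigen-identity to every **weak Laplacian pair** `(u, s)`, i.e. any `u, s ∈ 𝓚` with
`⟪Y_{m,k}, s⟫ = Λ_{|m|,k} ⟪Y_{m,k}, u⟫` for all `m, k` (`Λ = assocLegLevel`, the eigenvalue of
`-Δ̸` on `Y_{m,k}`):

* `oblateSphere_weak_of_pair`: `⟪Ψ_q, s⟫ - ν² ⟪Ψ_q, x² u⟫ = λ_q(ν) ⟪Ψ_q, u⟫`;
* `inner_oblateSphereBasis_of_pair_mode`: if `⟪Y_{m,k}, v⟫ = c(m) ⟪Y_{m,k}, u⟫` for all `m, k`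
  (a multiplier depending on the azimuthal number only, e.g. `c(m) = im` for `v = ∂_φ u`), then
  `⟪Ψ_q, v⟫ = c(q.1) ⟪Ψ_q, u⟫`.

Both are Parseval computations in the `Y`-basis; all hypotheses are countably many continuous
linear conditions on `(u, s)`, which is what survives an a.e.-in-frequency transport.

## References

* M. Dafermos, I. Rodnianski, Y. Shlapentokh-Rothman, arXiv:1402.7034, §5.2.1 (32), §5.2.2.
  [DafermosRodnianskiShlapentokhrothman2014]
-/

noncomputable section

open Real Set Filter MeasureTheory
open scoped Topology InnerProductSpace ComplexConjugate

namespace Literature.Analysis.SpecialFunctions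

open Literature.Analysis.FunctionSpaces

variable {T : ℝ} [hT : Fact (0 < T)]

/-- **The weak eigen-equation against weak Laplacian pairs.** If `u, s ∈ L²([-1,1] × 𝕋)` satisfy
`⟪Y_{m,k}, s⟫ = Λ_{|m|,k} ⟪Y_{m,k}, u⟫` for all `m, k`, then for every `ν` and every index `q`,
`⟪Ψ_q, s⟫ - ν² ⟪Ψ_q, x² u⟫ = λ_q(ν) ⟪Ψ_q, u⟫`.
[cite: DafermosRodnianskiShlapentokhrothman2014, §5.2.1 (32)] -/
theorem oblateSphere_weak_of_pair (ν : ℝ) (p : OblateSphereIndex ν) (u s : Lp ℂ 2 (sphereMeasure T))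
    (hpair : ∀ (m : ℤ) (k : ℕ),
      ⟪sphHarmTensor T m k, s⟫_ℂ = (assocLegLevel m.natAbs k : ℂ) * ⟪sphHarmTensor T m k, u⟫_ℂ) :
    ⟪oblateSphereBasis T ν p, s⟫_ℂ -
        ((ν ^ 2 : ℝ) : ℂ) * ⟪oblateSphereBasis T ν p, mulSqFst T u⟫_ℂ =
      (oblateSphereEig ν p : ℂ) * ⟪oblateSphereBasis T ν p, u⟫_ℂ := by
  obtain ⟨b, hb⟩ := exists_hilbertBasis_sphHarmTensor (T := T)
  have P1 := b.hasSum_inner_mul_inner (oblateSphereBasis T ν p) s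
  have P2 := b.hasSum_inner_mul_inner (oblateSphereBasis T ν p) u
  have P3 := b.hasSum_inner_mul_inner (mulSqFst T (oblateSphereBasis T ν p)) u
  have hterm : ∀ r : (Σ _ : ℤ, ℕ),
      ⟪oblateSphereBasis T ν p, b r⟫_ℂ * ⟪b r, s⟫_ℂ =
      (oblateSphereEig ν p : ℂ) * (⟪oblateSphereBasis T ν p, b r⟫_ℂ * ⟪b r, u⟫_ℂ) +
        ((ν ^ 2 : ℝ) : ℂ) * (⟪mulSqFst T (oblateSphereBasis T ν p), b r⟫_ℂ * ⟪b r, u⟫_ℂ) := by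
    intro r
    rw [hb r, hpair r.1 r.2]
    have hweak := oblateSphere_weak (T := T) ν p r.1 r.2
    have hconj := congrArg conj hweak
    simp only [map_sub, map_mul, Complex.conj_ofReal, inner_conj_symm] at hconj
    rw [inner_mulSqFst_comm]
    rw [inner_mulSqFst_comm] at hconj
    linear_combination ⟪sphHarmTensor T r.1 r.2, u⟫_ℂ * hconj
  have hfun : (fun r : (Σ _ : ℤ, ℕ) ↦ ⟪oblateSphereBasis T ν p, b r⟫_ℂ * ⟪b r, s⟫_ℂ) =
      fun r ↦ (oblateSphereEig ν p : ℂ) * (⟪oblateSphereBasis T ν p, b r⟫_ℂ * ⟪b r, u⟫_ℂ) +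
        ((ν ^ 2 : ℝ) : ℂ) * (⟪mulSqFst T (oblateSphereBasis T ν p), b r⟫_ℂ * ⟪b r, u⟫_ℂ) :=
    funext hterm
  rw [hfun] at P1
  have P4 := (P2.mul_left (oblateSphereEig ν p : ℂ)).add (P3.mul_left (((ν ^ 2 : ℝ) : ℂ)))
  have heq := P1.unique P4
  rw [inner_mulSqFst_comm] at heq
  linear_combination heq

/-- `⟪Ψ_q, Y_{m,k}⟫ = 0` unless `m = q.1` (orthogonality of the Fourier factor). [folklore] -/
theorem inner_oblateSphereBasis_sphHarmTensor_of_ne (ν : ℝ) (q : OblateSphereIndex ν) {m : ℤ}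
    (hm : m ≠ q.1) (k : ℕ) : ⟪oblateSphereBasis T ν q, sphHarmTensor T m k⟫_ℂ = 0 := by
  rw [oblateSphereBasis_apply, sphHarmTensor, inner_tensorLp_tensorLp, inner_fourierLp_fourierLp,
    if_neg (Ne.symm hm), mul_zero]

/-- **Azimuthal multipliers pass to `Ψ_q`.** If `⟪Y_{m,k}, v⟫ = c(m) ⟪Y_{m,k}, u⟫` for all `m, k`,
then `⟪Ψ_q, v⟫ = c(q.1) ⟪Ψ_q, u⟫`. [cite: DafermosRodnianskiShlapentokhrothman2014, §5.2.2] -/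
theorem inner_oblateSphereBasis_of_pair_mode (ν : ℝ) (q : OblateSphereIndex ν)
    (u v : Lp ℂ 2 (sphereMeasure T)) (c : ℤ → ℂ)
    (hpair : ∀ (m : ℤ) (k : ℕ), ⟪sphHarmTensor T m k, v⟫_ℂ = c m * ⟪sphHarmTensor T m k, u⟫_ℂ) :
    ⟪oblateSphereBasis T ν q, v⟫_ℂ = c q.1 * ⟪oblateSphereBasis T ν q, u⟫_ℂ := by
  obtain ⟨b, hb⟩ := exists_hilbertBasis_sphHarmTensor (T := T)
  have P1 := b.hasSum_inner_mul_inner (oblateSphereBasis T ν q) v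
  have P2 := b.hasSum_inner_mul_inner (oblateSphereBasis T ν q) u
  have hterm : ∀ r : (Σ _ : ℤ, ℕ), ⟪oblateSphereBasis T ν q, b r⟫_ℂ * ⟪b r, v⟫_ℂ =
      c q.1 * (⟪oblateSphereBasis T ν q, b r⟫_ℂ * ⟪b r, u⟫_ℂ) := by
    intro r
    rw [hb r, hpair r.1 r.2]
    by_cases hm : r.1 = q.1
    · rw [hm]
      ring
    · rw [inner_oblateSphereBasis_sphHarmTensor_of_ne ν q hm]
      ring
  have hfun : (fun r : (Σ _ : ℤ, ℕ) ↦ ⟪oblateSphereBasis T ν q, b r⟫_ℂ * ⟪b r, v⟫_ℂ) =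
      fun r ↦ c q.1 * (⟪oblateSphereBasis T ν q, b r⟫_ℂ * ⟪b r, u⟫_ℂ) := funext hterm
  rw [hfun] at P1
  exact P1.unique (P2.mul_left (c q.1))

end Literature.Analysis.SpecialFunctions
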